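import Summits.AnomalousDissipation.AnomalousDissipation.Theorems.TwoAndHalfDTwohalfdThesisStubGKFloorOfTailTools

/-!
# H1 `stub_gkFloorOfTail`: the Green–Kubo floor of a released family is AUTOMATIC for fast mixers

Tool stub H1 of the line `Sketch` (duhamel-release) for the crux
`Summit.AnomalousDissipation.AnomalousDissipation.Theses.TwoAndHalfD.TwohalfdThesis`
(stmt-AnomalousDissipation-0206), lead c3.  The line's kernel W (`stub_releasedMixingWitness`) asks a
steadily forced classical planar flow to mix ONE smooth zero-mean pattern `h` with a `j`-uniform
integrable `L²`-envelope `Λ` for the releases `φ s` of `h` (`‖φ s (t)‖² ≤ Λ(t-s)²‖h‖²`, `s ≥ s₀`) AND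
to obey a Green–Kubo / no-echo floor `ε ≤ liminf_T T⁻¹∫₀ᵀ (∫₀ᵗ ⟪h, φ s (t)⟫ ds) dt`.  This file
proves that the second clause follows from the first once the TAIL of the envelope beyond the
coherence time is small:

* `gkFloor_of_coherence_of_envelopeTail` (abstract form).  Let `κ > 0`, `h` smooth, zero-mean,
  `‖h‖² = N > 0`; releases `φ s` of `h` (classical, unforced, on `[s, ∞)`, every `s ≥ 0`) over one
  drift; a COHERENCE RATE `K > 0`: `⟪h, φ s (t)⟫ ≥ N - K (t - s)` (`0 ≤ s ≤ t`); an envelope `Λ ≥ 0`,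
  integrable on `[0, ∞)`, with `‖φ s (t)‖² ≤ Λ(t-s)² N` for `s₀ ≤ s ≤ t`; and the tail condition
  `∫_{[τ_c, ∞)} Λ ≤ τ_c / 4`, `τ_c := N / K` (the coherence time).  Then
  `N τ_c / 4 ≤ liminf_T T⁻¹∫₀ᵀ (∫₀ᵗ ⟪h, φ s (t)⟫ ds) dt`.
* `stub_gkFloorOfTail` (W's format).  The coherence rate of the landed coherence gate
  (`stub_coherenceOfEnergy`, p97305): `K = (‖Δh‖₂ + ‖∇h‖_∞ √E) ‖h‖₂` for a drift with pointwise
  kinetic energy `≤ E` and `κ ≤ 1`.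

So the no-echo clause of W is not an independent obstruction for FAST mixers: the kernel of the line
is ONE property — a `j`-uniform integrable mixing envelope whose tail beyond the (explicit, `j`-free)
coherence time `τ_c` carries at most `τ_c/4`.  (By the landed `stub_dissipationTimeLowerBound`,
p98639, the WHOLE envelope always carries `∫₀^∞ Λ ≥ τ_c/2`; the condition constrains only its tail.)

PROOF.  Fix `t ≥ s₀ + τ_c` and split the Duhamel integral `G(t) = ∫₀ᵗ C(s) ds`,
`C(s) := ⟪h, φ s (t)⟫` (continuous in `s` by forward–backward duality,
`exists_continuousOn_releasePairing`: `C(s) = ⟪h, χ̃(t-s)⟫` with `χ̃` the reversed solution from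
`h`, as in the landed weak Duhamel identity `stub_weakDuhamel`, p87403):
(young ages `s ∈ [t-τ_c, t]`) coherence gives `∫ ≥ N τ_c - K τ_c²/2 = N τ_c/2`;
(middle ages `s ∈ [s₀, t-τ_c]`) Cauchy–Schwarz and the envelope give `|C(s)| ≤ Λ(t-s) N`, so
`∫ ≥ -N ∫_{[τ_c,∞)} Λ ≥ -N τ_c/4`;
(early releases `s ∈ [0, s₀]`) the fixed-diffusivity decay of zero-mean releases
(`stub_fixedViscosityEnvelope`, p98636) gives `|C(s)| ≤ N e^{-4π²κ(t-s₀)}`, so `∫ ≥ -s₀ N e^{-4π²κ(t-s₀)}`.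
Hence `G(t) ≥ N τ_c/4 - s₀ N e^{-4π²κ(t-s₀)}`, eventually `≥ N τ_c/4 - δ`; `G` is locally integrable
(`G(t) = ⟪h, θ(t)⟫` for the classical cold start `θ`, weak Duhamel) and bounded
(`|G| ≤ (s₀ + ∫Λ) N`, the landed splitting estimate `integral_le_of_release_envelope`), so the Cesàro
means are eventually `≥ N τ_c/4 - 2δ` and bounded above, and `liminf ≥ N τ_c/4`
(`le_liminf_timeMean_of_eventually_le`).  The tools (duality continuity, pointwise bounds, bookkeeping, the
one-time lower bound `gk_integral_lower_bound`) live in `…StubGKFloorOfTailTools.lean`.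
Supports stmt-AnomalousDissipation-0206. [folklore: Taylor 1921 / Green–Kubo representation of the
eddy flux; DEIJ 2022, §1 (1.1)–(1.3); Evans 2010, §7.1.1 (adjoint problem)]
-/

noncomputable section

-- the summit path `AnomalousDissipation/AnomalousDissipation` duplicates a namespace component
set_option linter.dupNamespace false

namespace Summit.AnomalousDissipation.AnomalousDissipation.Theorems.TwohalfdThesis

open MeasureTheory Set Filter Topology
open scoped ENNReal NNReal InnerProductSpace
open Literature.Analysis.FunctionSpaces Literature.Analysis.FluidPDE

/-! ## The abstract theorem and the stub -/

/-- **Green–Kubo floor from coherence and a small envelope tail (abstract coherence rate).**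
`κ > 0`; `h` smooth, zero-mean, `N = ‖h‖²_{L²} > 0`; classical unforced releases `φ s` of `h` at
every `s ≥ 0` over one drift; a coherence rate `K > 0` (`⟪h, φ s (t)⟫ ≥ N - K(t-s)`, `0 ≤ s ≤ t`);
an envelope `Λ ≥ 0`, integrable on `[0, ∞)`, `‖φ s (t)‖² ≤ Λ(t-s)² N` for `s₀ ≤ s ≤ t`, whose tail
beyond the coherence time `τ_c = N/K` carries `∫_{[τ_c,∞)} Λ ≤ τ_c/4`.  Then the Green–Kubo clause
of W holds with `ε = N τ_c / 4`:
`N τ_c / 4 ≤ liminf_T T⁻¹ ∫₀ᵀ (∫₀ᵗ ⟪h, φ s (t)⟫ ds) dt`. [folklore] -/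
theorem gkFloor_of_coherence_of_envelopeTail {κ K s₀ : ℝ}
    {u : ℝ → UnitAddTorus (Fin 2) → EuclideanSpace ℝ (Fin 2)} {h : UnitAddTorus (Fin 2) → ℝ}
    {φ : ℝ → ℝ → UnitAddTorus (Fin 2) → ℝ} {Λ : ℝ → ℝ}
    (hκ : 0 < κ) (hh : Torus.IsSmooth h) (hhz : Torus.HasZeroMean h) (hK : 0 < K)
    (hφ : ∀ s, 0 ≤ s → Torus.IsClassicalScalarTransportOn (Ici s) κ u (φ s) ∧ φ s s = h)
    (hcoh : ∀ s t, 0 ≤ s → s ≤ t → Torus.scalarL2Sq h - K * (t - s) ≤ ∫ x, h x * φ s t x)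
    (hs₀ : 0 ≤ s₀) (hΛ : ∀ τ, 0 ≤ Λ τ) (hΛi : IntegrableOn Λ (Ici 0))
    (henv : ∀ s t, s₀ ≤ s → s ≤ t → Torus.scalarL2Sq (φ s t) ≤ Λ (t - s) ^ 2 * Torus.scalarL2Sq h)
    (htail : ∫ τ in Ici (Torus.scalarL2Sq h / K), Λ τ ≤ Torus.scalarL2Sq h / K / 4) :
    Torus.scalarL2Sq h * (Torus.scalarL2Sq h / K) / 4 ≤
      liminf (timeMean fun t => ∫ s in (0 : ℝ)..t, ∫ x, h x * φ s t x) atTop := by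
  set N : ℝ := Torus.scalarL2Sq h with hN_def
  set τc : ℝ := N / K with hτc_def
  have hN : 0 ≤ N := Torus.scalarL2Sq_nonneg h
  have hτc : 0 ≤ τc := div_nonneg hN hK.le
  set G : ℝ → ℝ := fun t => ∫ s in (0 : ℝ)..t, ∫ x, h x * φ s t x with hG_def
  -- the cold start `θ` and weak Duhamel: `G t = ∫ θ t h` for `t ≥ 0`
  have hu : Torus.IsSmoothSpaceTimeOn (Ici 0) u := (hφ 0 le_rfl).1.smooth_velocity
  have hdiv : ∀ σ ∈ Ici (0 : ℝ), Torus.IsDivFree (u σ) := fun σ hσ => (hφ 0 le_rfl).1.divFree σ hσ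
  obtain ⟨θ, hθ, hθ0⟩ :=
    ScalarAnomalySteadySourceFormal.ColdStartVariance.exists_global_coldStart hκ hu hdiv hh
  have hGθ : ∀ t, 0 ≤ t → G t = ∫ x, θ t x * h x := by
    intro t ht
    rw [stub_weakDuhamel κ u h θ φ hκ hh hθ hθ0 hφ h hh t ht, hG_def]
    refine intervalIntegral.integral_congr fun s _ => ?_
    exact integral_congr_ae (Eventually.of_forall fun x => mul_comm _ _)
  have hQc : ContinuousOn (fun t => ∫ x, θ t x * h x) (Ici 0) :=
    (hθ.smooth_scalar.mul (Torus.isSmoothSpaceTimeOn_const hh _)).continuousOn_integral (convex_Ici 0)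
  have hGi : ∀ T, 0 ≤ T → IntervalIntegrable G volume 0 T := by
    intro T hT
    have h1 : ContinuousOn (fun t => ∫ x, θ t x * h x) (uIcc 0 T) :=
      hQc.mono (by rw [uIcc_of_le hT]; exact Icc_subset_Ici_self)
    refine h1.intervalIntegrable.congr ?_
    intro t ht
    rw [uIoc_of_le hT] at ht
    exact (hGθ t ht.1.le).symm
  -- `G` is bounded: `|G t| ≤ (s₀ + M) N`, `M = ∫ Λ`
  set M : ℝ := ∫ τ in Ici 0, Λ τ with hM_def
  have hGb : ∀ t, 0 < t → |G t| ≤ (s₀ + M) * N := by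
    intro t ht
    have hF1 : ∀ s, 0 < s → s ≤ t → |∫ x, h x * φ s t x| ≤ Real.sqrt N * Real.sqrt N := by
      intro s hs hst
      rw [Real.mul_self_sqrt hN]
      exact abs_releasePairing_le hκ.le hh (hφ s hs.le).1 (hφ s hs.le).2 hst
    have hF2 : ∀ s, 0 < s → s₀ < s → s ≤ t →
        |∫ x, h x * φ s t x| ≤ Λ (t - s) * Real.sqrt N * Real.sqrt N := by
      intro s hs hs₀s hst
      rw [mul_assoc, Real.mul_self_sqrt hN]
      exact abs_releasePairing_le_of_envelope hh
        ((hφ s hs.le).1.smooth_scalar.isSmooth_slice (show t ∈ Ici s from hst)) (hΛ _)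
        (henv s t hs₀s.le hst)
    have hup := integral_le_of_release_envelope (Real.sqrt_nonneg N) (Real.sqrt_nonneg N) hs₀ ht.le
      hΛ hΛi le_rfl hF1 hF2
    have hF1' : ∀ s, 0 < s → s ≤ t → |-(∫ x, h x * φ s t x)| ≤ Real.sqrt N * Real.sqrt N :=
      fun s hs hst => by rw [abs_neg]; exact hF1 s hs hst
    have hF2' : ∀ s, 0 < s → s₀ < s → s ≤ t →
        |-(∫ x, h x * φ s t x)| ≤ Λ (t - s) * Real.sqrt N * Real.sqrt N :=
      fun s hs hs₀s hst => by rw [abs_neg]; exact hF2 s hs hs₀s hst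
    have hlow := integral_le_of_release_envelope (Real.sqrt_nonneg N) (Real.sqrt_nonneg N) hs₀ ht.le
      hΛ hΛi le_rfl hF1' hF2'
    rw [intervalIntegral.integral_neg] at hlow
    rw [mul_assoc, Real.mul_self_sqrt hN] at hup hlow
    have hlow' : -(G t) ≤ (s₀ + M) * N := by simpa [hG_def] using hlow
    have hup' : G t ≤ (s₀ + M) * N := by simpa [hG_def] using hup
    exact abs_le.2 ⟨neg_le.1 hlow', hup'⟩
  -- eventually `G t ≥ N τc / 4 - δ`
  have hev : ∀ δ, 0 < δ → ∃ T₁, 0 ≤ T₁ ∧ ∀ t, T₁ ≤ t → N * τc / 4 - δ ≤ G t := by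
    intro δ hδ
    -- the early-release error `s₀ N √(e^{-8π²κ(t-s₀)})` tends to `0`
    have hlim : Tendsto (fun t => s₀ * N * Real.sqrt (Real.exp (-(8 * Real.pi ^ 2 * κ) * (t - s₀))))
        atTop (𝓝 0) := by
      have hc : 0 < 8 * Real.pi ^ 2 * κ := by positivity
      have h1 : Tendsto (fun t => -(8 * Real.pi ^ 2 * κ) * (t - s₀)) atTop atBot := by
        have h2 : Tendsto (fun t : ℝ => t - s₀) atTop atTop :=
          (tendsto_atTop_add_const_right atTop (-s₀) tendsto_id).congr fun x => by
            simp [sub_eq_add_neg]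
        exact h2.const_mul_atTop_of_neg (by linarith)
      have h3 : Tendsto (fun t => Real.exp (-(8 * Real.pi ^ 2 * κ) * (t - s₀))) atTop (𝓝 0) :=
        Real.tendsto_exp_atBot.comp h1
      have h4 : Tendsto (fun t => Real.sqrt (Real.exp (-(8 * Real.pi ^ 2 * κ) * (t - s₀)))) atTop
          (𝓝 0) := by
        have := (Real.continuous_sqrt.tendsto 0).comp h3
        simpa [Function.comp_def] using this
      simpa using h4.const_mul (s₀ * N)
    have hevδ : ∀ᶠ t in atTop,
        s₀ * N * Real.sqrt (Real.exp (-(8 * Real.pi ^ 2 * κ) * (t - s₀))) < δ :=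
      hlim (Iio_mem_nhds hδ)
    obtain ⟨T₁, hT₁⟩ := eventually_atTop.1 hevδ
    refine ⟨max T₁ (s₀ + τc), le_max_of_le_right (by linarith), fun t ht => ?_⟩
    have h1 := gk_integral_lower_bound hκ hh hhz hK hφ hcoh hs₀ hΛ hΛi henv htail
      ((le_max_right _ _).trans ht)
    have h2 := hT₁ t ((le_max_left _ _).trans ht)
    change N * (N / K) / 4 - s₀ * N * Real.sqrt (Real.exp (-(8 * Real.pi ^ 2 * κ) * (t - s₀))) ≤ G t
      at h1
    rw [← hτc_def] at h1
    linarith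
  have hmain := le_liminf_timeMean_of_eventually_le hGi hGb hev
  simpa [hτc_def] using hmain

/-- **H1 `stub_gkFloorOfTail` (line `Sketch` = duhamel-release, crux `TwoAndHalfD.TwohalfdThesis`;
registered signature): the Green–Kubo floor of W is automatic for fast mixers.** In W's format:
`0 < κ ≤ 1`, a drift with pointwise kinetic energy `∫‖u(t)‖² ≤ E` (`t ≥ 0`), a smooth zero-mean
pattern `h` with `‖h‖² > 0`, classical unforced releases `φ s` of `h` at every `s ≥ 0`, an envelope
`Λ ≥ 0` integrable on `[0,∞)` with `‖φ s (t)‖² ≤ Λ(t-s)²‖h‖²` for `s₀ ≤ s ≤ t`.  With the coherence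
rate of the landed coherence gate `K = (‖Δh‖₂ + ‖∇h‖_∞ √E)‖h‖₂ > 0` and the coherence time
`τ_c = ‖h‖²/K`: if `∫_{[τ_c,∞)} Λ ≤ τ_c/4` then
`‖h‖² τ_c / 4 ≤ liminf_T T⁻¹∫₀ᵀ (∫₀ᵗ ⟪h, φ s (t)⟫ ds) dt` — W's Green–Kubo clause with
`ε = ‖h‖² τ_c / 4`.  Proof: `gkFloor_of_coherence_of_envelopeTail` with the coherence inequality
`stub_coherenceOfEnergy` (p97305). [folklore] -/
theorem stub_gkFloorOfTail :
    ∀ (κ E K s₀ : ℝ) (u : ℝ → (UnitAddTorus (Fin 2)) → (EuclideanSpace ℝ (Fin 2)))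
      (h : (UnitAddTorus (Fin 2)) → ℝ) (φ : ℝ → ℝ → (UnitAddTorus (Fin 2)) → ℝ) (Λ : ℝ → ℝ),
      0 < κ → κ ≤ 1 → Torus.IsSmooth h → Torus.HasZeroMean h →
      K = (Real.sqrt (Torus.scalarL2Sq (Torus.laplacian h)) +
            (⨆ x, ‖Torus.gradient h x‖) * Real.sqrt E) * Real.sqrt (Torus.scalarL2Sq h) →
      0 < K →
      (∀ t, 0 ≤ t → ∫ x, ‖u t x‖ ^ 2 ≤ E) →
      (∀ s, 0 ≤ s → Torus.IsClassicalScalarTransportOn (Ici s) κ u (φ s) ∧ φ s s = h) →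
      0 ≤ s₀ → (∀ τ, 0 ≤ Λ τ) → IntegrableOn Λ (Ici 0) →
      (∀ s t, s₀ ≤ s → s ≤ t → Torus.scalarL2Sq (φ s t) ≤ Λ (t - s) ^ 2 * Torus.scalarL2Sq h) →
      (∫ τ in Ici (Torus.scalarL2Sq h / K), Λ τ) ≤ Torus.scalarL2Sq h / K / 4 →
      Torus.scalarL2Sq h * (Torus.scalarL2Sq h / K) / 4 ≤
        liminf (timeMean fun t => ∫ s in (0 : ℝ)..t, ∫ x, h x * φ s t x) atTop := by
  intro κ E K s₀ u h φ Λ hκ hκ1 hh hhz hKdef hK hE hφ hs₀ hΛ hΛi henv htail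
  refine gkFloor_of_coherence_of_envelopeTail hκ hh hhz hK hφ (fun s t hs hst => ?_) hs₀ hΛ hΛi
    henv htail
  have hc := stub_coherenceOfEnergy κ E s u h (φ s) hκ.le hκ1 hh (hφ s hs).1 (hφ s hs).2
    (fun t' ht' => hE t' (hs.trans ht')) t hst
  rw [hKdef]
  exact hc

end Summit.AnomalousDissipation.AnomalousDissipation.Theorems.TwohalfdThesis

end
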